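import Literature.Topology.FourManifolds.BandSumUnitChart
import Literature.Topology.FourManifolds.BandSumUnitProfiles
import Literature.Topology.FourManifolds.CurveFamilyIsotopy
import Literature.Topology.FourManifolds.AffineAmbientIsotopy
import Literature.Topology.FourManifolds.GluckTwistTransport
import HarnessLib

/-!
# The unknot is a unit for the connected sum, III: the small unknot below the flat arc

Topic `Literature/Topology/FourManifolds`; third file of the discharge of
`Literature.Topology.FourManifolds.Knot.exists_isConnectedSum_unknot_isIsotopic` (`BandSum.lean`;
Rolfsen (1976), §2.G). For a flat-arc configuration `C` (`BandSumUnitChart.lean`) and the scale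
`λ = C.lam`, the planar D-loop family `dloop λ τ` (`BandSumUnitProfiles.lean`) is lifted through the
vertical plane of the arc into `𝕊³`:

* `FlatArcConfig.liftLoop γ` — the loop `t ↦ ψ⁻¹ (planeMap (γ t))` of a planar curve, a regular
  loop of period one when `γ` is smooth, `1`-periodic and regular (`isRegularLoop_liftLoop`);
  smooth families lift to smooth families.
* `FlatArcConfig.oKnot τ` — the knot of the lifted D-loop stage `τ` (`t ↦ dloop λ τ (2π t)`):
  `oKnot 0` is a round circle of (chart) radius `λ` centred at depth `3λ/2` below the arc, `oKnot 1`
  is **the small unknot `O`** of the band sum, the D-loop with its flat top at depth `λ`;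
  `oKnot_circlePoint : oKnot τ (cos θ, sin θ) = toSphere (dloop λ τ θ)`; the stages are isotopic
  (`isIsotopic_oKnot`, by `IsRegularLoop.isIsotopic_of_family_eq`, i.e. the isotopy extension theorem
  of `IsotopyExtension.lean` applied to the family of lifted loops).
* `BandSumUnit.frameMap t` — the linear map of `ℝ³` sending the chart frame `frame i` to prescribed
  vectors `t i`, with its matrix `toMat (frameMap t) = Tᵗ... ` (columns `t k`) `· (frame k j)` and the
  sign-corrected choice `FlatArcConfig.oTargets` (`(λ/2) e`, `(λ/2) e₂`, `± (λ/2) e × e₂`) of positive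
  determinant; `FlatArcConfig.oEquiv` — the resulting automorphism of `ℝ³`.
* `FlatArcConfig.unknot_isIsotopic_oKnot_one` — **`O` is unknotted**: the affine ambient isotopy of
  `ℝ³` from the identity to `z ↦ c_O + oEquiv z` (`AffineIsotopy.exists_ambientIsotopy_affine`,
  `GL⁺₃` is connected), transported to `𝕊³` along `ψ` (`AmbientIsotopy.alongChart`), carries the
  standard unknot — which reads `2 cos θ • frame 0 + 2 sin θ • frame 1` in the chart (`psi_unknot`) —
  onto `oKnot 0` on the nose; composing with `oKnot 0 ≃ oKnot 1` gives `unknot ≃ O`.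

## References

* D. Rolfsen, *Knots and Links* (1976), §2.G. [Rolfsen1976]
* M. W. Hirsch, *Differential Topology* (1976), Ch. 8 §1, Thm. 1.3; Ch. 8 §3, Thm. 3.1. [HirschDT1976]

## Design notes

All statements are `[folklore]`; no named facts, no `sorry`. `𝔼 n`, `𝕊 n` are local notation.
-/

open scoped Manifold ContDiff Topology RealInnerProductSpace Real
open Function Set Metric Module

noncomputable section

namespace Literature.Topology.FourManifolds

/-- Local notation: `𝔼 n` is the model Euclidean space `EuclideanSpace ℝ (Fin n)`. -/
local notation "𝔼 " n:arg => EuclideanSpace ℝ (Fin n)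

/-- Local notation: `𝕊 n` is the unit sphere in `EuclideanSpace ℝ (Fin (n + 1))`. -/
local notation "𝕊 " n:arg => (Metric.sphere (0 : EuclideanSpace ℝ (Fin (n + 1))) 1)

attribute [local instance] fact_finrank_euclideanSpace_succ

namespace BandSumUnit

open KnotsInBall

/-! ### Orthonormal triples in `ℝ³` -/

/-- An orthonormal triple in `ℝ³` is an orthonormal basis. [folklore] -/
def onbOfTriple {v : Fin 3 → 𝔼 3} (hv : Orthonormal ℝ v) : OrthonormalBasis (Fin 3) ℝ (𝔼 3) :=
  OrthonormalBasis.mk hv (hv.linearIndependent.span_eq_top_of_card_eq_finrank (by simp)).ge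

/-- The orthonormal basis of a triple is the triple. [folklore] -/
@[simp] theorem coe_onbOfTriple {v : Fin 3 → 𝔼 3} (hv : Orthonormal ℝ v) : ⇑(onbOfTriple hv) = v :=
  OrthonormalBasis.coe_mk _ _

/-- Expansion of a vector in an orthonormal triple. [folklore] -/
theorem sum_inner_smul_of_orthonormal {v : Fin 3 → 𝔼 3} (hv : Orthonormal ℝ v) (z : 𝔼 3) :
    ∑ i, ⟪z, v i⟫ • v i = z := by
  conv_rhs => rw [← (onbOfTriple hv).sum_repr z]
  refine Finset.sum_congr rfl fun i _ ↦ ?_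
  rw [(onbOfTriple hv).repr_apply_apply, coe_onbOfTriple, real_inner_comm]

/-- Expansion with the inner products written the other way round. [folklore] -/
theorem sum_inner_smul_of_orthonormal' {v : Fin 3 → 𝔼 3} (hv : Orthonormal ℝ v) (z : 𝔼 3) :
    ∑ i, ⟪v i, z⟫ • v i = z := by
  conv_rhs => rw [← sum_inner_smul_of_orthonormal hv z]
  exact Finset.sum_congr rfl fun i _ ↦ by rw [real_inner_comm]

/-! ### Linear maps prescribed on the chart frame -/

open AffineIsotopy in
/-- Entries of the matrix of an operator: `toMat A i j = (A eⱼ)ᵢ`. [folklore] -/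
theorem toMat_apply (A : 𝔼 3 →L[ℝ] 𝔼 3) (i j : Fin 3) :
    toMat A i j = A (EuclideanSpace.single j 1) i := by
  conv_rhs => rw [← toCLM_toMat A]
  rw [toCLM_apply]
  simp [PiLp.single_apply, Finset.sum_ite_eq']

/-- **The frame map**: the operator on `ℝ³` sending `frame i ↦ t i`. [folklore] -/
def frameMap (t : Fin 3 → 𝔼 3) : 𝔼 3 →L[ℝ] 𝔼 3 := ∑ i, (innerSL ℝ (frame i)).smulRight (t i)

/-- The frame map applied. [folklore] -/
theorem frameMap_apply (t : Fin 3 → 𝔼 3) (z : 𝔼 3) : frameMap t z = ∑ i, ⟪frame i, z⟫ • t i := by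
  simp [frameMap, ContinuousLinearMap.smulRight_apply]

/-- The frame map on the frame. [folklore] -/
@[simp] theorem frameMap_frame (t : Fin 3 → 𝔼 3) (j : Fin 3) : frameMap t (frame j) = t j := by
  rw [frameMap_apply]
  simp only [inner_frame_frame]
  rw [Finset.sum_eq_single j]
  · simp
  · intro i _ hij; simp [hij]
  · simp

/-- The frame map on a combination of `frame 0`, `frame 1`. [folklore] -/
theorem frameMap_combo (t : Fin 3 → 𝔼 3) (a b : ℝ) :
    frameMap t (a • frame 0 + b • frame 1) = a • t 0 + b • t 1 := by
  rw [map_add, map_smul, map_smul, frameMap_frame, frameMap_frame]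

/-- The matrix of frame coordinates `(frame k)ⱼ`. [folklore] -/
def frameMat : Matrix (Fin 3) (Fin 3) ℝ := Matrix.of fun k j ↦ frame k j

/-- The matrix with columns `t k`. [folklore] -/
def colMat (t : Fin 3 → 𝔼 3) : Matrix (Fin 3) (Fin 3) ℝ := Matrix.of fun i k ↦ t k i

open AffineIsotopy in
/-- **The matrix of the frame map** is `(columns t k) · (frame coordinates)`. [folklore] -/
theorem toMat_frameMap (t : Fin 3 → 𝔼 3) : toMat (frameMap t) = colMat t * frameMat := by
  ext i j
  rw [toMat_apply, frameMap_apply, Matrix.mul_apply]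
  simp only [colMat, frameMat, Matrix.of_apply]
  rw [show (∑ k, ⟪frame k, EuclideanSpace.single j (1 : ℝ)⟫ • t k) i =
      ∑ k, (⟪frame k, EuclideanSpace.single j (1 : ℝ)⟫ • t k) i from by simp]
  refine Finset.sum_congr rfl fun k _ ↦ ?_
  rw [PiLp.smul_apply, EuclideanSpace.inner_single_right, smul_eq_mul]
  simp [mul_comm]

/-- The frame-coordinate matrix is orthogonal: `F · Fᵀ = 1`. [folklore] -/
theorem frameMat_mul_transpose : frameMat * frameMat.transpose = 1 := by
  ext k l
  rw [Matrix.mul_apply, Matrix.one_apply]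
  simp only [frameMat, Matrix.transpose_apply, Matrix.of_apply]
  have h : ⟪frame k, frame l⟫ = ∑ j, frame k j * frame l j := by
    rw [PiLp.inner_apply]
    exact Finset.sum_congr rfl fun j _ ↦ by simp [mul_comm]
  rw [← h, inner_frame_frame]

/-- `(det F)² = 1`. [folklore] -/
theorem det_frameMat_sq : frameMat.det ^ 2 = 1 := by
  have h := congrArg Matrix.det frameMat_mul_transpose
  rw [Matrix.det_mul, Matrix.det_transpose, Matrix.det_one] at h
  nlinarith [h]

/-- `det F = 1 ∨ det F = -1`. [folklore] -/
theorem det_frameMat_eq : frameMat.det = 1 ∨ frameMat.det = -1 := by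
  have h := det_frameMat_sq
  have : (frameMat.det - 1) * (frameMat.det + 1) = 0 := by ring_nf; linarith
  rcases mul_eq_zero.1 this with h1 | h1
  · left; linarith
  · right; linarith

/-- `det F ≠ 0`. [folklore] -/
theorem det_frameMat_ne_zero : frameMat.det ≠ 0 := by
  rcases det_frameMat_eq with h | h <;> rw [h] <;> norm_num

/-- `|det F| = 1`, as `det F * det F = 1`. [folklore] -/
theorem det_frameMat_mul_self : frameMat.det * frameMat.det = 1 := by
  have := det_frameMat_sq; rwa [sq] at this

namespace FlatArcConfig

variable (C : FlatArcConfig)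

/-! ### The horizontal normal of the arc plane -/

/-- The horizontal unit vector `w₀ = (e₁, -e₀, 0)` orthogonal to `e` and to `e₂`. [folklore] -/
def wvec : 𝔼 3 := WithLp.toLp 2 ![C.e 1, -C.e 0, 0]

/-- Coordinates of `wvec`. [folklore] -/
@[simp] theorem wvec_apply_zero : C.wvec 0 = C.e 1 := rfl
/-- Coordinates of `wvec`. [folklore] -/
@[simp] theorem wvec_apply_one : C.wvec 1 = -C.e 0 := rfl
/-- Coordinates of `wvec`. [folklore] -/
@[simp] theorem wvec_apply_two : C.wvec 2 = 0 := rfl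

/-- `e₀² + e₁² = 1` (`e` is a horizontal unit vector). [folklore] -/
theorem e_sq_add : C.e 0 ^ 2 + C.e 1 ^ 2 = 1 := by
  have h := C.norm_e
  have h2 : ‖C.e‖ ^ 2 = 1 := by rw [h]; norm_num
  rw [EuclideanSpace.norm_sq_eq, Fin.sum_univ_three] at h2
  simp only [Real.norm_eq_abs, sq_abs, C.e_two] at h2
  linarith

/-- `⟪e, w₀⟫ = 0`. [folklore] -/
@[simp] theorem inner_e_wvec : ⟪C.e, C.wvec⟫ = 0 := by
  rw [PiLp.inner_apply, Fin.sum_univ_three]; simp [C.e_two]; ring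

/-- `⟪w₀, e⟫ = 0`. [folklore] -/
@[simp] theorem inner_wvec_e : ⟪C.wvec, C.e⟫ = 0 := by rw [real_inner_comm, inner_e_wvec]

/-- `⟪vert, w₀⟫ = 0`. [folklore] -/
@[simp] theorem inner_vert_wvec : ⟪vert, C.wvec⟫ = 0 := by rw [inner_vert_left]; rfl

/-- `⟪w₀, vert⟫ = 0`. [folklore] -/
@[simp] theorem inner_wvec_vert : ⟪C.wvec, vert⟫ = 0 := by rw [inner_vert_right]; rfl

/-- `⟪w₀, w₀⟫ = 1`. [folklore] -/
@[simp] theorem inner_wvec_wvec : ⟪C.wvec, C.wvec⟫ = 1 := by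
  rw [PiLp.inner_apply, Fin.sum_univ_three]; simp; nlinarith [C.e_sq_add]

/-- `‖w₀‖ = 1`. [folklore] -/
@[simp] theorem norm_wvec : ‖C.wvec‖ = 1 := by
  rw [← Real.sqrt_sq (norm_nonneg _), ← real_inner_self_eq_norm_sq, inner_wvec_wvec, Real.sqrt_one]

/-- The triple `(e, e₂, w₀)`. [folklore] -/
def triple : Fin 3 → 𝔼 3 := ![C.e, vert, C.wvec]

/-- The triple `(e, e₂, w₀)` is orthonormal. [folklore] -/
theorem orthonormal_triple : Orthonormal ℝ C.triple := by
  rw [orthonormal_iff_ite]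
  intro i j
  fin_cases i <;> fin_cases j <;>
    simp [triple, C.norm_e, C.inner_e_vert, C.inner_vert_e, C.inner_e_wvec, C.inner_wvec_e,
      C.inner_vert_wvec, C.inner_wvec_vert, norm_vert]

/-! ### The target vectors of the unknot placement -/

/-- **The targets** of the frame map placing the unknot: `frame 0 ↦ (λ/2) e`, `frame 1 ↦ (λ/2) e₂`,
`frame 2 ↦ ± (λ/2) w₀`, the sign `det F` making the determinant positive. [folklore] -/
def oTargets : Fin 3 → 𝔼 3 :=
  ![(C.lam / 2) • C.e, (C.lam / 2) • vert, (frameMat.det * (C.lam / 2)) • C.wvec]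

/-- `oTargets 0`. [folklore] -/
@[simp] theorem oTargets_zero : C.oTargets 0 = (C.lam / 2) • C.e := rfl
/-- `oTargets 1`. [folklore] -/
@[simp] theorem oTargets_one : C.oTargets 1 = (C.lam / 2) • vert := rfl
/-- `oTargets 2`. [folklore] -/
@[simp] theorem oTargets_two : C.oTargets 2 = (frameMat.det * (C.lam / 2)) • C.wvec := rfl

/-- The signs `σ i ∈ {1, det F}` relating targets and the triple: `oTargets i = (σ i · λ/2) • triple i`.
[folklore] -/
def oSign : Fin 3 → ℝ := ![1, 1, frameMat.det]

/-- `oTargets i = (oSign i * λ/2) • triple i`. [folklore] -/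
theorem oTargets_eq (i : Fin 3) : C.oTargets i = (oSign i * (C.lam / 2)) • C.triple i := by
  fin_cases i <;> simp [oTargets, oSign, triple]

/-- `oSign i * oSign i = 1`. [folklore] -/
theorem oSign_mul_self (i : Fin 3) : oSign i * oSign i = 1 := by
  fin_cases i
  · simp [oSign]
  · simp [oSign]
  · exact det_frameMat_mul_self

/-- **The determinant of the placement is positive**: `det (toMat (frameMap oTargets)) = (λ/2)³`.
[folklore] -/
theorem det_toMat_frameMap_oTargets :
    (AffineIsotopy.toMat (frameMap C.oTargets)).det = (C.lam / 2) ^ 3 := by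
  rw [toMat_frameMap, Matrix.det_mul]
  have hT : (colMat C.oTargets).det = frameMat.det * (C.lam / 2) ^ 3 := by
    rw [Matrix.det_fin_three]
    simp only [colMat, Matrix.of_apply, oTargets_zero, oTargets_one, oTargets_two, PiLp.smul_apply,
      smul_eq_mul, vert_apply, wvec_apply_zero, wvec_apply_one, wvec_apply_two, C.e_two]
    simp only [Fin.isValue, Fin.reduceEq, ↓reduceIte]
    have := C.e_sq_add
    linear_combination (frameMat.det * (C.lam / 2) ^ 3) * this
  rw [hT, mul_assoc, mul_comm ((C.lam / 2) ^ 3), ← mul_assoc, det_frameMat_mul_self, one_mul]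

/-- The inverse of the placement: `y ↦ ∑ᵢ (4/λ²) ⟪oTargets i, y⟫ • frame i`. [folklore] -/
def oInverse : 𝔼 3 →L[ℝ] 𝔼 3 :=
  ∑ i, (innerSL ℝ ((4 / C.lam ^ 2) • C.oTargets i)).smulRight (frame i)

/-- The inverse applied. [folklore] -/
theorem oInverse_apply (y : 𝔼 3) :
    C.oInverse y = ∑ i, (4 / C.lam ^ 2 * ⟪C.oTargets i, y⟫) • frame i := by
  simp [oInverse, ContinuousLinearMap.smulRight_apply]

/-- Inner products of the targets: `⟪oTargets i, oTargets j⟫ = (λ/2)² δᵢⱼ`. [folklore] -/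
theorem inner_oTargets (i j : Fin 3) :
    ⟪C.oTargets i, C.oTargets j⟫ = if i = j then (C.lam / 2) ^ 2 else 0 := by
  rw [oTargets_eq, oTargets_eq, inner_smul_left, inner_smul_right,
    orthonormal_iff_ite.1 C.orthonormal_triple]
  by_cases h : i = j
  · subst h; simp only [if_true, conj_trivial]
    have := oSign_mul_self i
    linear_combination (C.lam / 2) ^ 2 * this
  · simp [h]

/-- `oInverse ∘ frameMap oTargets = id`. [folklore] -/
theorem oInverse_frameMap (z : 𝔼 3) : C.oInverse (frameMap C.oTargets z) = z := by
  rw [frameMap_apply, oInverse_apply]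
  have hl : C.lam ≠ 0 := C.lam_pos.ne'
  have key : ∀ i, 4 / C.lam ^ 2 * ⟪C.oTargets i, ∑ j, ⟪frame j, z⟫ • C.oTargets j⟫ = ⟪frame i, z⟫ := by
    intro i
    rw [inner_sum, Finset.sum_eq_single i]
    · rw [inner_smul_right, inner_oTargets]
      simp only [if_true]
      field_simp
      ring
    · intro j _ hji
      rw [inner_smul_right, inner_oTargets, if_neg (Ne.symm hji)]; simp
    · simp
  simp_rw [key]
  exact sum_inner_smul_of_orthonormal' orthonormal_frame z

/-- `frameMap oTargets ∘ oInverse = id`. [folklore] -/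
theorem frameMap_oInverse (y : 𝔼 3) : frameMap C.oTargets (C.oInverse y) = y := by
  rw [oInverse_apply, map_sum]
  simp_rw [map_smul, frameMap_frame]
  have hl : C.lam ≠ 0 := C.lam_pos.ne'
  have key : ∀ i, (4 / C.lam ^ 2 * ⟪C.oTargets i, y⟫) • C.oTargets i = ⟪C.triple i, y⟫ • C.triple i := by
    intro i
    rw [oTargets_eq, inner_smul_left, smul_smul]
    simp only [conj_trivial]
    congr 1
    have := oSign_mul_self i
    field_simp
    linear_combination (4 : ℝ) * ⟪C.triple i, y⟫ * this
  simp_rw [key]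
  exact sum_inner_smul_of_orthonormal' C.orthonormal_triple y

/-- **The placement automorphism** `oEquiv : ℝ³ ≃ ℝ³`, `frame i ↦ oTargets i`. [folklore] -/
def oEquiv : 𝔼 3 ≃L[ℝ] 𝔼 3 :=
  ContinuousLinearEquiv.equivOfInverse (frameMap C.oTargets) C.oInverse C.oInverse_frameMap
    C.frameMap_oInverse

/-- `oEquiv` as a map is `frameMap oTargets`. [folklore] -/
@[simp] theorem coe_oEquiv : (C.oEquiv : 𝔼 3 →L[ℝ] 𝔼 3) = frameMap C.oTargets := rfl

/-- `oEquiv z = frameMap oTargets z`. [folklore] -/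
theorem oEquiv_apply (z : 𝔼 3) : C.oEquiv z = frameMap C.oTargets z := rfl

/-- The centre `c_O = planeMap (0, 3λ/2)` of the round circle (depth `3λ/2` below the base point).
[folklore] -/
def oCenter : 𝔼 3 := C.planeMap (pt2 0 (3 * C.lam / 2))

/-- **The placement carries the chart unknot onto the round circle below the arc**:
`c_O + oEquiv (2 cos θ • frame 0 + 2 sin θ • frame 1) = planeMap (dloop λ 0 θ)`. [folklore] -/
theorem oCenter_add_oEquiv (θ : ℝ) :
    C.oCenter + C.oEquiv ((2 * Real.cos θ) • frame 0 + (2 * Real.sin θ) • frame 1) =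
      C.planeMap (dloop C.lam 0 θ) := by
  rw [oEquiv_apply, frameMap_combo, oTargets_zero, oTargets_one, dloop_zero, oCenter, planeMap_pt2,
    planeMap_pt2, smul_smul, smul_smul]
  module

/-! ### Loops in the arc plane lifted to the sphere -/

/-- **The lift of a planar curve**: `t ↦ ψ⁻¹ (planeMap (γ t)) ∈ ℝ⁴`. [folklore] -/
def liftLoop (γ : ℝ → 𝔼 2) (t : ℝ) : 𝔼 4 := ((C.toSphere (γ t) : 𝕊 3) : 𝔼 4)

/-- Pointwise formula. [folklore] -/
theorem liftLoop_apply (γ : ℝ → 𝔼 2) (t : ℝ) : C.liftLoop γ t = ((C.toSphere (γ t) : 𝕊 3) : 𝔼 4) := rfl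

/-- Lifted points are equal iff the planar points are. [folklore] -/
theorem liftLoop_eq_iff {γ : ℝ → 𝔼 2} {s t : ℝ} : C.liftLoop γ s = C.liftLoop γ t ↔ γ s = γ t := by
  rw [liftLoop_apply, liftLoop_apply, Subtype.coe_inj, C.toSphere_injective.eq_iff]

/-- A smooth family of planar curves lifts to a smooth family. [folklore] -/
theorem contDiff_liftLoop_family {Γ : ℝ → ℝ → 𝔼 2} (hΓ : ContDiff ℝ ∞ (uncurry Γ)) :
    ContDiff ℝ ∞ (uncurry fun τ ↦ C.liftLoop (Γ τ)) :=
  C.contDiff_coe_toSphere.comp hΓ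

/-- A smooth planar curve lifts to a smooth curve. [folklore] -/
theorem contDiff_liftLoop {γ : ℝ → 𝔼 2} (hγ : ContDiff ℝ ∞ γ) : ContDiff ℝ ∞ (C.liftLoop γ) :=
  C.contDiff_coe_toSphere.comp hγ

/-- **Regular loops lift to regular loops**: the lift of a smooth, `1`-periodic, regular planar
curve is a regular loop of period one on `𝕊³`. [folklore] -/
theorem isRegularLoop_liftLoop {γ : ℝ → 𝔼 2} (hγ : ContDiff ℝ ∞ γ) (hper : Periodic γ 1)
    (hreg : ∀ t, deriv γ t ≠ 0) : IsRegularLoop (C.liftLoop γ) where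
  contDiff := C.contDiff_liftLoop hγ
  periodic t := by rw [liftLoop_apply, liftLoop_apply, hper]
  norm_eq_one t := norm_eq_of_mem_sphere _
  deriv_ne_zero t := C.deriv_coe_toSphere_comp_ne_zero (hγ.differentiable (by simp) t) (hreg t)

/-! ### The small unknot and its round relative -/

/-- The D-loop stage `τ` as a curve of period one: `t ↦ dloop λ τ (2π t)`. [folklore] -/
def oCurve (τ t : ℝ) : 𝔼 2 := dloop C.lam τ (2 * π * t)

/-- The family `oCurve` is jointly smooth. [folklore] -/
theorem contDiff_oCurve : ContDiff ℝ ∞ (uncurry C.oCurve) := by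
  have : uncurry C.oCurve =
      (fun p : ℝ × ℝ ↦ dloop C.lam p.1 p.2) ∘ fun p : ℝ × ℝ ↦ (p.1, 2 * π * p.2) := rfl
  rw [this]
  exact (contDiff_dloop C.lam).comp (contDiff_fst.prodMk ((contDiff_const.mul contDiff_snd)))

/-- Each stage of `oCurve` is smooth. [folklore] -/
theorem contDiff_oCurve_stage (τ : ℝ) : ContDiff ℝ ∞ (C.oCurve τ) := by
  have : C.oCurve τ = dloop C.lam τ ∘ fun t : ℝ ↦ 2 * π * t := rfl
  rw [this]
  exact (contDiff_dloop_stage C.lam τ).comp (contDiff_const.mul contDiff_id)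

/-- Each stage of `oCurve` is `1`-periodic. [folklore] -/
theorem periodic_oCurve (τ : ℝ) : Periodic (C.oCurve τ) 1 := fun t ↦ by
  simp only [oCurve]; rw [mul_add, mul_one, dloop_add_two_pi]

/-- The velocity of a stage of `oCurve`. [folklore] -/
theorem deriv_oCurve (τ t : ℝ) : deriv (C.oCurve τ) t = (2 * π) • deriv (dloop C.lam τ) (2 * π * t) := by
  show deriv (fun t ↦ dloop C.lam τ (2 * π * t)) t = _
  rw [deriv_comp_mul_left (2 * π) (dloop C.lam τ) t]

/-- Each stage of `oCurve` is regular. [folklore] -/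
theorem deriv_oCurve_ne_zero (τ t : ℝ) : deriv (C.oCurve τ) t ≠ 0 := by
  rw [deriv_oCurve]
  exact smul_ne_zero (by positivity) (deriv_dloop_ne_zero C.lam_pos τ _)

/-- **The lifted D-loop stages are regular loops.** [folklore] -/
theorem isRegularLoop_oLoop (τ : ℝ) : IsRegularLoop (C.liftLoop (C.oCurve τ)) :=
  C.isRegularLoop_liftLoop (C.contDiff_oCurve_stage τ) (C.periodic_oCurve τ) (C.deriv_oCurve_ne_zero τ)

/-- **The lifted D-loop stages are simple** for `τ ∈ [0, 1]`. [folklore] -/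
theorem oLoop_simple {τ : ℝ} (hτ : τ ∈ Icc (0 : ℝ) 1) (s t : ℝ)
    (h : C.liftLoop (C.oCurve τ) s = C.liftLoop (C.oCurve τ) t) : ∃ m : ℤ, t - s = m := by
  rw [liftLoop_eq_iff] at h
  obtain ⟨k, hk⟩ := dloop_eq_dloop_imp C.lam_pos hτ h
  refine ⟨-k, ?_⟩
  have : 2 * π * (t - s) = 2 * π * (-k) := by nlinarith [hk]
  have := mul_left_cancel₀ (by positivity : (2 * π : ℝ) ≠ 0) this
  push_cast at this ⊢; linarith

/-- Clamp of the stage parameter into `[0, 1]`. [folklore] -/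
def clamp (τ : ℝ) : ℝ := max 0 (min τ 1)

/-- The clamp lands in `[0, 1]`. [folklore] -/
theorem clamp_mem (τ : ℝ) : clamp τ ∈ Icc (0 : ℝ) 1 :=
  ⟨le_max_left _ _, max_le zero_le_one (min_le_right _ _)⟩

/-- The clamp is the identity on `[0, 1]`. [folklore] -/
theorem clamp_of_mem {τ : ℝ} (hτ : τ ∈ Icc (0 : ℝ) 1) : clamp τ = τ := by
  rw [clamp, min_eq_left hτ.2, max_eq_right hτ.1]

/-- **The knot `O_τ`** of the lifted D-loop stage `τ` (clamped into `[0, 1]`): `oKnot 0` is the round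
circle of radius `λ` at depth `3λ/2` below the arc, `oKnot 1` the small unknot `O` of the band sum.
[folklore] -/
def oKnot (τ : ℝ) : Knot :=
  (C.isRegularLoop_oLoop (clamp τ)).toKnot (C.oLoop_simple (clamp_mem τ))

/-- **Values of `O_τ`**: `O_τ (cos θ, sin θ) = toSphere (dloop λ τ θ)` for `τ ∈ [0, 1]`. [folklore] -/
theorem oKnot_circlePoint {τ : ℝ} (hτ : τ ∈ Icc (0 : ℝ) 1) (θ : ℝ) :
    C.oKnot τ (circlePoint θ) = C.toSphere (dloop C.lam τ θ) := by
  apply Subtype.ext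
  rw [oKnot, IsRegularLoop.coe_toKnot_circlePoint, liftLoop_apply, oCurve, clamp_of_mem hτ,
    ← mul_assoc, mul_inv_cancel₀ (by positivity : (2 * π : ℝ) ≠ 0), one_mul]

/-- The range of `O_τ` is the lift of the range of the D-loop stage. [folklore] -/
theorem range_oKnot {τ : ℝ} (hτ : τ ∈ Icc (0 : ℝ) 1) :
    range (C.oKnot τ) = C.toSphere '' range (dloop C.lam τ) := by
  ext y
  constructor
  · rintro ⟨x, rfl⟩
    obtain ⟨θ, rfl⟩ := circlePoint_surjective x
    exact ⟨_, ⟨θ, rfl⟩, (C.oKnot_circlePoint hτ θ).symm⟩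
  · rintro ⟨_, ⟨θ, rfl⟩, rfl⟩
    exact ⟨circlePoint θ, C.oKnot_circlePoint hτ θ⟩

/-- Membership in the range of `O_τ`. [folklore] -/
theorem mem_range_oKnot_iff {τ : ℝ} (hτ : τ ∈ Icc (0 : ℝ) 1) {y : 𝕊 3} :
    y ∈ range (C.oKnot τ) ↔ ∃ θ, y = C.toSphere (dloop C.lam τ θ) := by
  rw [range_oKnot C hτ]
  constructor
  · rintro ⟨_, ⟨θ, rfl⟩, rfl⟩; exact ⟨θ, rfl⟩
  · rintro ⟨θ, rfl⟩; exact ⟨_, ⟨θ, rfl⟩, rfl⟩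

/-- **The stages are isotopic**: `O_0 ≃ O_1` (the family of lifted D-loop stages is a smooth family
of simple regular loops; isotopy extension). [cite: HirschDT1976, Ch. 8 §1, Thm. 1.3] -/
theorem isIsotopic_oKnot_zero_one : (C.oKnot 0).IsIsotopic (C.oKnot 1) := by
  have h0 : clamp 0 = 0 := clamp_of_mem ⟨le_rfl, zero_le_one⟩
  have h1 : clamp 1 = 1 := clamp_of_mem ⟨zero_le_one, le_rfl⟩
  have h := IsRegularLoop.isIsotopic_of_family_eq (C := fun τ ↦ C.liftLoop (C.oCurve τ))
    (C.isRegularLoop_oLoop (clamp 0)) (C.isRegularLoop_oLoop (clamp 1))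
    (C.oLoop_simple (clamp_mem 0)) (C.oLoop_simple (clamp_mem 1))
    (C.contDiff_liftLoop_family C.contDiff_oCurve) (fun τ _ ↦ C.isRegularLoop_oLoop τ)
    (fun τ hτ ↦ C.oLoop_simple hτ) (by rw [h0]) (by rw [h1])
  exact h

/-! ### The small unknot is unknotted -/

section Unknot

variable [SphereEmbedding.SmoothnessFacts]

/-- **The standard unknot is ambient isotopic to the round circle `O_0` below the arc.** The affine
ambient isotopy of `ℝ³` from the identity to `z ↦ c_O + oEquiv z` on the ball of radius `2`
(`AffineIsotopy.exists_ambientIsotopy_affine`; both determinants positive), transported along `ψ`,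
moves `unknot` — read `2 cos θ • frame 0 + 2 sin θ • frame 1` in the chart — onto `O_0` pointwise.
[cite: HirschDT1976, Ch. 8 §3, Thm. 3.1 (proof)] -/
theorem unknot_isIsotopic_oKnot_zero : unknot.IsIsotopic (C.oKnot 0) := by
  have hdet : 0 < (AffineIsotopy.toMat ((ContinuousLinearEquiv.refl ℝ (𝔼 3) : 𝔼 3 ≃L[ℝ] 𝔼 3) :
      𝔼 3 →L[ℝ] 𝔼 3)).det * (AffineIsotopy.toMat (C.oEquiv : 𝔼 3 →L[ℝ] 𝔼 3)).det := by
    rw [ContinuousLinearEquiv.coe_refl, AffineIsotopy.toMat_id, Matrix.det_one, one_mul, coe_oEquiv,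
      det_toMat_frameMap_oTargets]
    have := C.lam_pos; positivity
  obtain ⟨F, hF1, R, hR⟩ := AffineIsotopy.exists_ambientIsotopy_affine (q₀ := 0) (q₁ := C.oCenter)
    (c := 0) (L₀ := ContinuousLinearEquiv.refl ℝ (𝔼 3)) (L₁ := C.oEquiv) hdet 2
  set G := F.alongChart (φ := psi) contMDiffOn_psi contMDiff_psi_symm psi_target hR with hG
  have key : unknot.map (G.toDiffeomorph 1) = C.oKnot 0 := by
    apply SphereEmbedding.ext
    funext x
    obtain ⟨θ, rfl⟩ := circlePoint_surjective x
    change G.toFun 1 (unknot (circlePoint θ)) = C.oKnot 0 (circlePoint θ)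
    rw [hG, AmbientIsotopy.alongChart_toFun,
      chartTransport_of_mem _ (mem_psi_source (unknot_ne_southPole _)), psi_unknot,
      C.oKnot_circlePoint ⟨le_rfl, zero_le_one⟩, toSphere_apply, ← C.oCenter_add_oEquiv θ]
    congr 1
    have h := hF1 ((2 * Real.cos θ) • frame 0 + (2 * Real.sin θ) • frame 1) (by
      rw [mem_closedBall, dist_zero_right]
      have hn : ‖(2 * Real.cos θ) • frame 0 + (2 * Real.sin θ) • frame 1‖ ^ 2 = 4 := by
        rw [← real_inner_self_eq_norm_sq]
        simp only [inner_add_left, inner_add_right, inner_smul_left, inner_smul_right,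
          inner_frame_frame]
        simp only [Fin.isValue, ↓reduceIte, one_ne_zero, zero_ne_one, conj_trivial]
        nlinarith [Real.sin_sq_add_cos_sq θ]
      nlinarith [norm_nonneg ((2 * Real.cos θ) • frame 0 + (2 * Real.sin θ) • frame 1)])
    simpa using h
  rw [← key]
  exact SphereEmbedding.isIsotopic_map _ G

/-- **The small unknot is unknotted**: `unknot ≃ O = oKnot 1`. [cite: Rolfsen1976, §2.G] -/
theorem unknot_isIsotopic_oKnot_one : unknot.IsIsotopic (C.oKnot 1) :=
  SphereEmbedding.IsIsotopic.trans_holds C.unknot_isIsotopic_oKnot_zero C.isIsotopic_oKnot_zero_one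

end Unknot

end FlatArcConfig

end BandSumUnit

end Literature.Topology.FourManifolds
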